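import Literature.MathematicalPhysics.QuantumLattice.HubbardNNNHoppingEnergyDensityParticleHole
import Literature.MathematicalPhysics.QuantumLattice.HubbardNNNHoppingEnergyDensityMonotone
import Literature.MathematicalPhysics.QuantumLattice.HubbardTTPrimeDiagHopTransport
import HarnessLib

/-!
# Ventures/CertifiedManyBodySolver — Certificates/HubbardSquare_n1_electronSideRow_holeStripFloor.lean (hubbard-box-eng-2 g16, cell hubbard-fast; t′-face transport)

HONEST FRAMING: transport bookkeeping of a certified ground-state-energy LOWER bound at half filling; zero compute, no definition, no
`sorry`; nothing is asserted unconditionally — the producer rows enter BY HYPOTHESIS as literal inequalities (10-dp OUTWARD roundings of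
the producers' exact rationals), exactly as the cell's `hsX…`/`hN…` hypotheses do. Not a superconductivity verdict; not a pairing bound;
no phase sentence.

THE DEVICE (`halfFilling_holeStrip_floor_of_electronSide_row`): at density `n = 1` the square-lattice `t–t′–U` Hubbard energy density is EVEN in
`t′` (particle–hole, `energyDensityTT'_particleHole_one`), NON-DECREASING in `t′` on the hole side `t′ ≤ 0`
(`monotoneOn_energyDensityTT'_tPrime_one`, concavity + evenness) and NON-DECREASING in `U` (Griffiths, `energyDensityTT'_mono_U`). Hence ONE
certified floor `f ≤ e(1, +s₀, U₀, 1)` at an ELECTRON-side station `s₀ ≥ 0` floors the whole hole-side strip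
`{(s, U) : −s₀ ≤ s ≤ 0, U ≥ U₀}` by the same number: `f ≤ e(1, s, U, 1)`.

INSTANCES (literal hypotheses; provenance): `hB54` = hubbard-algo row B54, K8cL⁺ (nvar 631 047) cell-certified TL e₀ LOWER at
(U, n, t′) = (6, 1, +3/10): `e₀ ≥ −0.7010542702` (10-dp floor of the exact rational, den 5·2⁸⁰; hubbard-algo-eng-8 g4 CLAIM algoeng8-20260829-42,
kit j331667, pub/hubbard-algo STATUS l.2431; hubbard-algo-ref g61 VERDICT CELL-SIDE PASS l.2433, errata CLEARED l.2452) ⇒ `n1_B54_holeStrip_floor`: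
`−0.7010542702 ≤ e(1, s, U, 1)` for every `s ∈ [−3/10, 0]`, `U ≥ 6` (and the left-edge point form `n1_B54_leftEdge_tpm3o10_U6`);
`hB67c` = hubbard-algo row B67 EDITION c, K8cL⁺ TL e₀ LOWER at (8, 1, +3/10): `e₀ ≥ −0.5566907601` (CLAIM algoeng8-20260829-44, kit j333861,
algo STATUS l.2441; algo-ref g61 VERDICT CELL-SIDE PASS l.2444) ⇒ `n1_B67c_holeStrip_floor` on `[−3/10, 0] × [8, ∞)`.
USE (pub/hubbard-downfold, `Observables/PhaseSeparationExclusion*`): these are `n = 1` COLUMN LAWS (constant in `s`) for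
`floor_on_cell_of_columnLaws` / `ps_not_groundState_mix_on_cell_of_columns`, replacing the K2DIAG-anchored `lsco_n1_law29_of` values
(−0.8626 ∣ −0.8381 ∣ −0.8137 at s = −3/10 ∣ −1/4 ∣ −1/5, U = 29/5) on the La-214 low-`U` face `U ≥ 6`; located arithmetic in
HOME/hubbard-box-eng-2/tables/g16/PRICED-g16.md §(B)3.
WHAT THIS IS NOT: a registry row; a new certificate; a statement at `U < U₀` or at `t′ < −s₀`; a cap.
-/

noncomputable section

namespace Summit.Ventures.CertifiedManyBodySolver.Certificates

open Literature.MathematicalPhysics.QuantumLattice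
open Literature.MathematicalPhysics.QuantumLattice.ThermodynamicLimit
open Set

/-- **Half-filling hole-strip floor from ONE electron-side row.** `t = 1`, `n = 1`: a floor `f ≤ e(1, s₀, U₀, 1)` at `s₀ ≥ 0`, `U₀ ≥ 0`
gives `f ≤ e(1, s, U, 1)` for every `s ∈ [−s₀, 0]` and every `U ≥ U₀` (particle–hole evenness in `t′` at `n = 1`, monotonicity in
`t′` on `t′ ≤ 0`, Griffiths monotonicity in `U`). -/
theorem halfFilling_holeStrip_floor_of_electronSide_row {s₀ U₀ f : ℝ} (hs₀ : 0 ≤ s₀) (hU₀ : 0 ≤ U₀)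
    (h : f ≤ energyDensityTT' 1 s₀ U₀ 1) :
    ∀ s ∈ Icc (-s₀) 0, ∀ U : ℝ, U₀ ≤ U → f ≤ energyDensityTT' 1 s U 1 := by
  intro s hs U hU
  have hph : energyDensityTT' 1 (-s₀) U₀ 1 = energyDensityTT' 1 s₀ U₀ 1 :=
    energyDensityTT'_particleHole_one 1 s₀ hU₀
  have hmono : energyDensityTT' 1 (-s₀) U₀ 1 ≤ energyDensityTT' 1 s U₀ 1 :=
    monotoneOn_energyDensityTT'_tPrime_one 1 hU₀
      (show -s₀ ∈ Iic (0 : ℝ) by simpa using hs₀) (show s ∈ Iic (0 : ℝ) from hs.2) hs.1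
  have hmonoU : energyDensityTT' 1 s U₀ 1 ≤ energyDensityTT' 1 s U 1 :=
    energyDensityTT'_mono_U 1 s (n := 1) zero_le_one one_lt_two hU₀ hU
  calc f ≤ energyDensityTT' 1 s₀ U₀ 1 := h
    _ = energyDensityTT' 1 (-s₀) U₀ 1 := hph.symm
    _ ≤ energyDensityTT' 1 s U₀ 1 := hmono
    _ ≤ energyDensityTT' 1 s U 1 := hmonoU

/-- **The same device, electron-side output**: the row also floors `s ∈ [0, s₀]`, `U ≥ U₀` (antitone in `t′` on `t′ ≥ 0`). -/
theorem halfFilling_electronStrip_floor_of_electronSide_row {s₀ U₀ f : ℝ} (hs₀ : 0 ≤ s₀) (hU₀ : 0 ≤ U₀)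
    (h : f ≤ energyDensityTT' 1 s₀ U₀ 1) :
    ∀ s ∈ Icc 0 s₀, ∀ U : ℝ, U₀ ≤ U → f ≤ energyDensityTT' 1 s U 1 := by
  intro s hs U hU
  have hanti : energyDensityTT' 1 s₀ U₀ 1 ≤ energyDensityTT' 1 s U₀ 1 :=
    antitoneOn_energyDensityTT'_tPrime_one 1 hU₀
      (show s ∈ Ici (0 : ℝ) from hs.1) (show s₀ ∈ Ici (0 : ℝ) from hs₀) hs.2
  have hmonoU : energyDensityTT' 1 s U₀ 1 ≤ energyDensityTT' 1 s U 1 :=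
    energyDensityTT'_mono_U 1 s (n := 1) zero_le_one one_lt_two hU₀ hU
  exact h.trans (hanti.trans hmonoU)

/-! ## Instances: hubbard-algo K8cL⁺ half-filling rows at `t′ = +3/10` read on the hole strip `t′ ∈ [−3/10, 0]` -/

/-- **B54 (6, 1, +3/10) ⇒ hole-strip floor**: `hB54 : −0.7010542702 ≤ e(1, 3/10, 6, 1)` (hubbard-algo B54, K8cL⁺ TL e₀ LOWER, 10-dp floor;
CLAIM algoeng8-20260829-42 kit j331667, algo-ref g61 CELL-SIDE PASS) gives `−0.7010542702 ≤ e(1, s, U, 1)` for all `s ∈ [−3/10, 0]`, `U ≥ 6`. -/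
theorem n1_B54_holeStrip_floor (hB54 : ((-3505271351/5000000000 : ℚ) : ℝ) ≤ energyDensityTT' 1 (3 / 10) 6 1) :
    ∀ s ∈ Icc (-3 / 10 : ℝ) 0, ∀ U : ℝ, 6 ≤ U → ((-3505271351/5000000000 : ℚ) : ℝ) ≤ energyDensityTT' 1 s U 1 := by
  have h := halfFilling_holeStrip_floor_of_electronSide_row (s₀ := 3 / 10) (U₀ := 6) (by norm_num) (by norm_num) hB54
  intro s hs U hU
  exact h s ⟨by linarith [hs.1], hs.2⟩ U hU

/-- **B54, left-edge point form** (the input shape of `halfFilling_floor_on_cell_of_leftEdge_floors` / `energyDensityTT'_uchord_floor_of_mem_Icc`):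
`−0.7010542702 ≤ e(1, −3/10, 6, 1)`. -/
theorem n1_B54_leftEdge_tpm3o10_U6 (hB54 : ((-3505271351/5000000000 : ℚ) : ℝ) ≤ energyDensityTT' 1 (3 / 10) 6 1) :
    ((-3505271351/5000000000 : ℚ) : ℝ) ≤ energyDensityTT' 1 (-3 / 10) 6 1 :=
  n1_B54_holeStrip_floor hB54 (-3 / 10) (by norm_num) 6 le_rfl

/-- **B54 as an `s`-affine COLUMN LAW at `U = 6`** (slope `0`; the shape `L(s) ≤ e(1, s, U₀, 1)` consumed by `floor_on_cell_of_columnLaws`):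
`∀ s ∈ [−3/10, 0], −0.7010542702 + 0·s ≤ e(1, s, 6, 1)`. -/
theorem n1_B54_columnLaw_U6 (hB54 : ((-3505271351/5000000000 : ℚ) : ℝ) ≤ energyDensityTT' 1 (3 / 10) 6 1) :
    ∀ s ∈ Icc (-3 / 10 : ℝ) 0, ((-3505271351/5000000000 : ℚ) : ℝ) + (0 : ℝ) * s ≤ energyDensityTT' 1 s 6 1 := by
  intro s hs
  simpa using n1_B54_holeStrip_floor hB54 s hs 6 le_rfl

/-- **B67c (8, 1, +3/10) ⇒ hole-strip floor**: `hB67c : −0.5566907601 ≤ e(1, 3/10, 8, 1)` (hubbard-algo B67 EDITION c, K8cL⁺ TL e₀ LOWER, 10-dp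
floor; CLAIM algoeng8-20260829-44 kit j333861, algo-ref g61 CELL-SIDE PASS) gives `−0.5566907601 ≤ e(1, s, U, 1)` for all `s ∈ [−3/10, 0]`, `U ≥ 8`
(0.017 above the EXT5 sheet `hsX8m40n1` read at `m = 1`, −0.5739066943). -/
theorem n1_B67c_holeStrip_floor (hB67c : ((-5566907601/10000000000 : ℚ) : ℝ) ≤ energyDensityTT' 1 (3 / 10) 8 1) :
    ∀ s ∈ Icc (-3 / 10 : ℝ) 0, ∀ U : ℝ, 8 ≤ U → ((-5566907601/10000000000 : ℚ) : ℝ) ≤ energyDensityTT' 1 s U 1 := by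
  have h := halfFilling_holeStrip_floor_of_electronSide_row (s₀ := 3 / 10) (U₀ := 8) (by norm_num) (by norm_num) hB67c
  intro s hs U hU
  exact h s ⟨by linarith [hs.1], hs.2⟩ U hU

/-- **B67c as an `s`-affine COLUMN LAW at `U = 8`**: `∀ s ∈ [−3/10, 0], −0.5566907601 + 0·s ≤ e(1, s, 8, 1)`. -/
theorem n1_B67c_columnLaw_U8 (hB67c : ((-5566907601/10000000000 : ℚ) : ℝ) ≤ energyDensityTT' 1 (3 / 10) 8 1) :
    ∀ s ∈ Icc (-3 / 10 : ℝ) 0, ((-5566907601/10000000000 : ℚ) : ℝ) + (0 : ℝ) * s ≤ energyDensityTT' 1 s 8 1 := by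
  intro s hs
  simpa using n1_B67c_holeStrip_floor hB67c s hs 8 le_rfl

end Summit.Ventures.CertifiedManyBodySolver.Certificates

end
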